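import Literature.Analysis.FluidPDE.DuchonRobertCubicIdentity
import Literature.Analysis.FluidPDE.TorusPressurePoisson
import HarnessLib

/-!
# Duchon–Robert's tested momentum equation with the symmetric mollified field: decomposition

Analysis/FluidPDE file on the decomposition path of the named fact
`Torus.IsDistributionalNSSolutionOn.symmTestField_identity` (`FluidPDE/DuchonRobertLocalBalance`,
step F_eq of Duchon–Robert 2000, proof of Prop. 1, p. 250: the momentum equation tested with the
symmetric field `Φ = ψ u^K + (ψu) ⋆ K`, "multiply the equation for `u` by `u^ε`, the regularised
equation by `u`, and add"), itself a step of `Torus.duchon_robert_defect_exists_of` (DR Prop. 2) and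
of `Torus.IsDissipationMeasureOf.hasDuchonRobertDefect_of_steps` (DR Prop. 4).

The field `Φ(t) = Torus.symmTestField K (ψ t) (u t)` has no time regularity and is not an
admissible test field; the standard repair (Cheskidov–Constantin–Friedlander–Shvydkoy 2008, §3.1,
last paragraph; Constantin–E–Titi 1994, p. 208) mollifies in time as well. This file fixes the
regularisation and **reduces F_eq to three analytic steps**, recorded as named facts to be
discharged separately:

* **Definitions.** With `ū = Torus.stBar T u` (extension by zero), an even normalised time bump
  `ρ` and the torus mollifier `k = Torus.kernel ε`, `S := (ρ ⊗ k) ⋆` is the space–time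
  mollification `Torus.stConv ρ k` (componentwise: `Torus.vecStConv`);
  `wₙ := S ū` (`Torus.drVelocityApprox`) and
  `Φₙ := S [ψ wₙ^K + (ψ wₙ) ⋆ K]` (`Torus.drTestApprox`, the space–time mollification of
  `symmTestField K (ψ t) (wₙ t)`). Every term is an `stConv` of an integrable field, so joint
  smoothness is the tree's `Torus.contDiff_top_stLift_stConv`.
* **(E1)** `Torus.drTestApprox_isSpaceTimeTestIoo` (named fact): `Φₙ` is a space–time test field
  supported in `(0,T)` once the time radius is below the distance of `supp ψ` to `{0, T}`.
* **(E2)** `Torus.drTestApprox_timePairing` (named fact): the time-derivative pairing is *exact*,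
  `∫₀ᵀ∫ ⟪u, ∂ₜΦₙ⟫ = ∫₀ᵀ∫ ⟪wₙ, wₙ ⋆ K⟫ ∂ₜψ` — with `A = ⋆ₓK`, `S` self-adjoint (even kernels) and
  commuting with `∂ₜ` and `A`:
  `⟨ū, ∂ₜS(ψAw)⟩ + ⟨ū, ∂ₜSA(ψw)⟩ = ⟨w, ∂ₜ(ψAw)⟩ + ⟨Aw, ∂ₜ(ψw)⟩ = 2⟨w·Aw, ∂ₜψ⟩ + ∫∫ψ∂ₜ(w·Aw) = ⟨w·Aw, ∂ₜψ⟩`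
  (this is why the *symmetric* field is used: no Friedrichs commutator appears).
* **(E3)** `Torus.drTestApprox_limits` (named fact): as the radii tend to zero, the four pairings
  converge to those of `Φ` (`wₙ → u` in `L³_{t,x}`, space derivatives fall on the kernels, the
  pairings are `L^{3/2}–L³`).
* **Proved here.** `Torus.IsDistributionalNSSolutionOn.weakForm_split` — the distributional identity
  for a test field splits into its four pairings (each integrable on `(0,T) × T^d`; Fubini) — and the
  assembly `Torus.symmTestField_identity_of : (E1) → (E2) → (E3) → symmTestField_identity`: the split
  identity for `Φₙ`, with its first term replaced through (E2), passes to the limit by (E3); the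
  time bumps are taken with radii below `min(ε₀, T - T')/2` (`exists_contDiffBump_seq_lt`), the
  space radii `1/(n+4)`.

Template for the discharges: `FluidPDE/OnsagerCCFSTestField` (the same repair for the CCFS energy
balance: `integral_mul_stConv_odd_even`, `hasDerivAt_stConv_time`, `integral_mul_timeDeriv_cetTest`,
`tendsto_eLpNorm_iteratedTimeConv_sub`).

## References

* J. Duchon, R. Robert, *Inertial energy dissipation for weak solutions of incompressible Euler
  and Navier–Stokes equations*, Nonlinearity 13 (2000) 249–255, proof of Prop. 1 (p. 250).
  [DuchonRobert2000]
* A. Cheskidov, P. Constantin, S. Friedlander, R. Shvydkoy, *Energy conservation and Onsager's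
  conjecture for the Euler equations*, Nonlinearity 21 (2008), §3.1 (last paragraph). [CCFS2008]
-/

noncomputable section

open MeasureTheory Set Filter Topology Function UnitAddTorus
open scoped ENNReal NNReal Convolution ContDiff InnerProductSpace

namespace Literature.Analysis.FluidPDE.Torus

open Literature.Analysis.FunctionSpaces

variable {d : Type*} [Fintype d] [DecidableEq d]

/-! ## The approximating test fields -/

section Defs

/-- **Componentwise space–time mollification** of a vector field `U : ℝ × T^d → ℝ^d` by the product
kernel `ρ ⊗ k` (`Torus.stConv` on each component, reassembled by `Torus.vecField`). [folklore] -/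
def vecStConv (ρ : ℝ → ℝ) (k : UnitAddTorus d → ℝ) (U : ℝ × UnitAddTorus d → EuclideanSpace ℝ d) :
    ℝ → UnitAddTorus d → EuclideanSpace ℝ d :=
  vecField fun j => FunctionSpaces.Torus.stConv ρ k fun q => U q j

/-- **Duchon–Robert's regularised velocity** `wₙ = (ρ ⊗ k) ⋆ ū`: the space–time mollification of
the velocity extended by zero off `(0,T) × T^d` (`Torus.stBar`), the repair "mollify in time as
well" of Cheskidov–Constantin–Friedlander–Shvydkoy 2008, §3.1 (last paragraph) for Duchon–Robert's
test field. [folklore] -/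
def drVelocityApprox (T : ℝ) (u : ℝ → UnitAddTorus d → EuclideanSpace ℝ d) (ρ : ℝ → ℝ)
    (k : UnitAddTorus d → ℝ) : ℝ → UnitAddTorus d → EuclideanSpace ℝ d :=
  vecStConv ρ k (stBar T u)

/-- **The approximating symmetric test field** `Φₙ = (ρ ⊗ k) ⋆ [ψ wₙ^K + (ψ wₙ) ⋆ K]`: the
space–time mollification of the symmetric Duchon–Robert field `Torus.symmTestField K (ψ t) (wₙ t)`
of the regularised velocity (Duchon–Robert 2000, proof of Prop. 1, p. 250: "multiply the equation
for `u` by `u^ε`, the regularised equation by `u`, and add"). A genuine space–time test field,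
unlike `symmTestField K (ψ t) (u t)` itself (no time regularity). [cite: DuchonRobert2000, proof of Prop. 1 p. 250] -/
def drTestApprox (T : ℝ) (u : ℝ → UnitAddTorus d → EuclideanSpace ℝ d) (ρ : ℝ → ℝ)
    (k K : UnitAddTorus d → ℝ) (ψ : ℝ → UnitAddTorus d → ℝ) : ℝ → UnitAddTorus d → EuclideanSpace ℝ d :=
  vecStConv ρ k fun q => symmTestField K (ψ q.1) (drVelocityApprox T u ρ k q.1) q.2

omit [DecidableEq d] in
/-- Components of `vecStConv`. [folklore] -/
@[simp]
theorem vecStConv_apply (ρ : ℝ → ℝ) (k : UnitAddTorus d → ℝ) (U : ℝ × UnitAddTorus d → EuclideanSpace ℝ d)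
    (t : ℝ) (x : UnitAddTorus d) (j : d) :
    vecStConv ρ k U t x j = FunctionSpaces.Torus.stConv ρ k (fun q => U q j) t x :=
  rfl

end Defs

/-! ## The three analytic steps, as named facts -/

section Facts

/-- **(E1) The approximating symmetric field is a legitimate test field** (Duchon–Robert 2000,
proof of Prop. 1, p. 250, the "straightforward" regularisation; Cheskidov–Constantin–Friedlander–
Shvydkoy 2008, §3.1, last paragraph: mollified solutions as test functions). Transcription: for
`u` jointly measurable with `u ∈ L²((0,T) × T^d)`, a normalised bump `ρ = φ.normed` in time, the
torus mollifier `k = Torus.kernel ε` (`0 < ε ≤ 1/4`), a smooth kernel `K` and a scalar cut-off `ψ`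
with smooth space–time lift vanishing for `t ≤ a` and for `t ≥ b`, where `φ.rOut < a` and
`b + φ.rOut < T`, the field `Torus.drTestApprox T u ρ k K ψ` is a space–time test field supported in
`(0, T)` (`Torus.IsSpaceTimeTestIoo`): jointly smooth (space–time mollification of an integrable
field by a smooth product kernel, `Torus.contDiff_top_stLift_stConv`) and vanishing for
`t ≤ a - φ.rOut` and `t ≥ b + φ.rOut`. [cite: DuchonRobert2000, proof of Prop. 1 p. 250] -/
def drTestApprox_isSpaceTimeTestIoo : Prop :=
  ∀ {T : ℝ} {u : ℝ → UnitAddTorus d → EuclideanSpace ℝ d}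
    (_hmeas : AEStronglyMeasurable (FunctionSpaces.Torus.stLift u) (volume.restrict (Ioo 0 T ×ˢ univ)))
    (_hu2 : ∫⁻ t in Ioo 0 T, ∫⁻ x, ‖u t x‖ₑ ^ 2 < ⊤)
    (φ : ContDiffBump (0 : ℝ)) {ε : ℝ} (_hε : 0 < ε) (_hε' : ε ≤ 1 / 4)
    {K : UnitAddTorus d → ℝ} (_hK : FunctionSpaces.Torus.IsSmooth K)
    {ψ : ℝ → UnitAddTorus d → ℝ} (_hψ : ContDiff ℝ ∞ (FunctionSpaces.Torus.stLift ψ))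
    {a b : ℝ} (_ha : ∀ t ≤ a, ψ t = 0) (_hb : ∀ t, b ≤ t → ψ t = 0)
    (_hra : φ.rOut < a) (_hrb : b + φ.rOut < T),
    FunctionSpaces.Torus.IsSpaceTimeTestIoo T
      (drTestApprox T u (φ.normed volume) (FunctionSpaces.Torus.kernel ε) K ψ)

/-- **(E2) The time-derivative pairing is exact** (Duchon–Robert 2000, proof of Prop. 1, p. 250:
the sum of "(NS) · u^ε" and "(NS^ε) · u" produces `∂ₜ(u·u^ε)`; in the regularised form: with
`S = (ρ ⊗ k) ⋆` (self-adjoint for even `ρ`, `k`, commuting with `∂ₜ` and with `A = ⋆ₓ K`, `K` even)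
and `w = S ū`,
`⟨ū, ∂ₜ S(ψ A w)⟩ + ⟨ū, ∂ₜ S A(ψ w)⟩ = ⟨w, ∂ₜ(ψ Aw)⟩ + ⟨Aw, ∂ₜ(ψ w)⟩ = 2⟨w·Aw, ∂ₜψ⟩ + ∫∫ ψ ∂ₜ(w·Aw)
= ⟨w·Aw, ∂ₜψ⟩`). Transcription: for `u` jointly measurable in `L²((0,T) × T^d)`, `ρ = φ.normed`,
`k = Torus.kernel ε` (`0 < ε ≤ 1/4`), `K` smooth and even and a scalar test function `ψ` supported
in `(0,T)`, with `w = Torus.drVelocityApprox T u ρ k` and `Φ = Torus.drTestApprox T u ρ k K ψ`: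
`∫₀ᵀ∫ ⟪u, ∂ₜΦ⟫ = ∫₀ᵀ∫ ⟪w, w ⋆ K⟫ ∂ₜψ`. [cite: DuchonRobert2000, proof of Prop. 1 p. 250] -/
def drTestApprox_timePairing : Prop :=
  ∀ {T : ℝ} {u : ℝ → UnitAddTorus d → EuclideanSpace ℝ d}
    (_hmeas : AEStronglyMeasurable (FunctionSpaces.Torus.stLift u) (volume.restrict (Ioo 0 T ×ˢ univ)))
    (_hu2 : ∫⁻ t in Ioo 0 T, ∫⁻ x, ‖u t x‖ₑ ^ 2 < ⊤)
    (φ : ContDiffBump (0 : ℝ)) {ε : ℝ} (_hε : 0 < ε) (_hε' : ε ≤ 1 / 4)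
    {K : UnitAddTorus d → ℝ} (_hK : FunctionSpaces.Torus.IsSmooth K) (_hKev : ∀ z, K (-z) = K z)
    {ψ : ℝ → UnitAddTorus d → ℝ} (_hψ : FunctionSpaces.Torus.IsSpaceTimeTestIoo T ψ),
    ∫ t in Ioo 0 T, ∫ x, ⟪u t x, FunctionSpaces.Torus.timeDeriv
        (drTestApprox T u (φ.normed volume) (FunctionSpaces.Torus.kernel ε) K ψ) t x⟫_ℝ =
      ∫ t in Ioo 0 T, ∫ x,
        ⟪drVelocityApprox T u (φ.normed volume) (FunctionSpaces.Torus.kernel ε) t x,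
          vecConv (drVelocityApprox T u (φ.normed volume) (FunctionSpaces.Torus.kernel ε) t) K x⟫_ℝ *
        FunctionSpaces.Torus.timeDeriv ψ t x

/-- **(E3) The regularisation is removed** (Duchon–Robert 2000, proof of Prop. 1, pp. 250–251, the
passage from the regularised identity to the identity for `(u, p)`; Cheskidov–Constantin–
Friedlander–Shvydkoy 2008, §3.1: continuity of mollification in `L³_{t,x}`). Transcription: for a
jointly measurable `u ∈ L³((0,T) × T^d)`, a jointly measurable `p ∈ L^{3/2}((0,T) × T^d)`, `K`
smooth and even, a scalar test function `ψ` supported in `(0,T)`, bumps `φₙ` with radii `→ 0` and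
space radii `εₙ → 0` (`0 < εₙ ≤ 1/4`), with `wₙ = Torus.drVelocityApprox T u ρₙ kₙ`,
`Φₙ = Torus.drTestApprox T u ρₙ kₙ K ψ` and `Φ(t) = Torus.symmTestField K (ψ t) (u t)`, as `n → ∞`:
`∫₀ᵀ∫ ⟪wₙ, wₙ ⋆ K⟫ ∂ₜψ → ∫₀ᵀ∫ ⟪u, u ⋆ K⟫ ∂ₜψ`, `∫₀ᵀ∫ ⟪u, (u·∇)Φₙ⟫ → ∫₀ᵀ∫ ⟪u, (u·∇)Φ⟫`,
`∫₀ᵀ∫ ⟪u, ΔΦₙ⟫ → ∫₀ᵀ∫ ⟪u, ΔΦ⟫`, `∫₀ᵀ∫ p div Φₙ → ∫₀ᵀ∫ p div Φ`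
(`wₙ → u` in `L³`, all space derivatives falling on the smooth kernels `k`, `K`; the pairings
are `L^{3/2}–L³`). [cite: DuchonRobert2000, proof of Prop. 1 pp. 250–251] -/
def drTestApprox_limits : Prop :=
  ∀ {T : ℝ} {u : ℝ → UnitAddTorus d → EuclideanSpace ℝ d} {p : ℝ → UnitAddTorus d → ℝ}
    (_hmeas : AEStronglyMeasurable (FunctionSpaces.Torus.stLift u) (volume.restrict (Ioo 0 T ×ˢ univ)))
    (_hu3 : ∫⁻ t in Ioo 0 T, ∫⁻ x, ‖u t x‖ₑ ^ 3 < ⊤)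
    (_hpmeas : AEStronglyMeasurable (FunctionSpaces.Torus.stLift p) (volume.restrict (Ioo 0 T ×ˢ univ)))
    (_hp : ∫⁻ t in Ioo 0 T, ∫⁻ x, ‖p t x‖ₑ ^ (3 / 2 : ℝ) < ⊤)
    {K : UnitAddTorus d → ℝ} (_hK : FunctionSpaces.Torus.IsSmooth K) (_hKev : ∀ z, K (-z) = K z)
    {ψ : ℝ → UnitAddTorus d → ℝ} (_hψ : FunctionSpaces.Torus.IsSpaceTimeTestIoo T ψ)
    (φ : ℕ → ContDiffBump (0 : ℝ)) (_hφ : Tendsto (fun n => (φ n).rOut) atTop (𝓝 0))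
    (ε : ℕ → ℝ) (_hε : ∀ n, 0 < ε n ∧ ε n ≤ 1 / 4) (_hε0 : Tendsto ε atTop (𝓝 0)),
    Tendsto (fun n => ∫ t in Ioo 0 T, ∫ x,
        ⟪drVelocityApprox T u ((φ n).normed volume) (FunctionSpaces.Torus.kernel (ε n)) t x,
          vecConv (drVelocityApprox T u ((φ n).normed volume) (FunctionSpaces.Torus.kernel (ε n)) t) K x⟫_ℝ *
        FunctionSpaces.Torus.timeDeriv ψ t x) atTop
      (𝓝 (∫ t in Ioo 0 T, ∫ x, ⟪u t x, vecConv (u t) K x⟫_ℝ * FunctionSpaces.Torus.timeDeriv ψ t x)) ∧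
    Tendsto (fun n => ∫ t in Ioo 0 T, ∫ x, ⟪u t x, FunctionSpaces.Torus.convect (u t)
        (drTestApprox T u ((φ n).normed volume) (FunctionSpaces.Torus.kernel (ε n)) K ψ t) x⟫_ℝ) atTop
      (𝓝 (∫ t in Ioo 0 T, ∫ x,
        ⟪u t x, FunctionSpaces.Torus.convect (u t) (symmTestField K (ψ t) (u t)) x⟫_ℝ)) ∧
    Tendsto (fun n => ∫ t in Ioo 0 T, ∫ x, ⟪u t x, FunctionSpaces.Torus.laplacian
        (drTestApprox T u ((φ n).normed volume) (FunctionSpaces.Torus.kernel (ε n)) K ψ t) x⟫_ℝ) atTop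
      (𝓝 (∫ t in Ioo 0 T, ∫ x,
        ⟪u t x, FunctionSpaces.Torus.laplacian (symmTestField K (ψ t) (u t)) x⟫_ℝ)) ∧
    Tendsto (fun n => ∫ t in Ioo 0 T, ∫ x, p t x * FunctionSpaces.Torus.divergence
        (drTestApprox T u ((φ n).normed volume) (FunctionSpaces.Torus.kernel (ε n)) K ψ t) x) atTop
      (𝓝 (∫ t in Ioo 0 T, ∫ x, p t x * FunctionSpaces.Torus.divergence (symmTestField K (ψ t) (u t)) x))

end Facts

end Literature.Analysis.FluidPDE.Torus

namespace Literature.Analysis.FluidPDE.Torus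

open Literature.Analysis.FunctionSpaces

variable {d : Type*} [Fintype d] [DecidableEq d]

/-! ## Splitting the distributional identity into its four pairings -/

section Split

variable {T ν : ℝ} {u : ℝ → UnitAddTorus d → EuclideanSpace ℝ d} {p : ℝ → UnitAddTorus d → ℝ}

omit [DecidableEq d] in
/-- A jointly smooth field on `ℝ × T^d` paired with an integrable field on `(0,T) × T^d` against a
bound: `(t, x) ↦ ⟪u, V⟫` is integrable when `u` is and `V` is jointly smooth. [folklore] -/
theorem integrable_inner_smooth {V : ℝ → UnitAddTorus d → EuclideanSpace ℝ d}
    (hV : FunctionSpaces.Torus.IsSmoothSpaceTimeOn univ V)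
    (hum : Integrable (uncurry u) ((volume.restrict (Ioo 0 T)).prod volume)) :
    Integrable (fun z : ℝ × UnitAddTorus d => ⟪u z.1 z.2, V z.1 z.2⟫_ℝ) ((volume.restrict (Ioo 0 T)).prod volume) := by
  obtain ⟨⟨C, hC0, hC⟩, hVm⟩ := hV.bound_and_measurable T
  have hIoo : ∀ᵐ z ∂((volume.restrict (Ioo 0 T)).prod (volume : Measure (UnitAddTorus d))), z.1 ∈ Ioo 0 T :=
    ae_prod_of_ae_fst (ae_restrict_mem measurableSet_Ioo)
  refine Integrable.mono' (hum.norm.mul_const C) (hum.1.inner hVm) ?_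
  filter_upwards [hIoo] with z hz
  exact (norm_inner_le_norm _ _).trans (mul_le_mul_of_nonneg_left (hC z.1 (Ioo_subset_Icc_self hz) z.2)
    (norm_nonneg _))

omit [DecidableEq d] in
/-- A jointly smooth scalar field paired with an integrable scalar field on `(0,T) × T^d`. [folklore] -/
theorem integrable_mul_smooth {g : ℝ → UnitAddTorus d → ℝ} (hg : FunctionSpaces.Torus.IsSmoothSpaceTimeOn univ g)
    (hpm : Integrable (uncurry p) ((volume.restrict (Ioo 0 T)).prod volume)) :
    Integrable (fun z : ℝ × UnitAddTorus d => p z.1 z.2 * g z.1 z.2) ((volume.restrict (Ioo 0 T)).prod volume) := by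
  obtain ⟨⟨C, hC0, hC⟩, hgm⟩ := hg.bound_and_measurable T
  have hIoo : ∀ᵐ z ∂((volume.restrict (Ioo 0 T)).prod (volume : Measure (UnitAddTorus d))), z.1 ∈ Ioo 0 T :=
    ae_prod_of_ae_fst (ae_restrict_mem measurableSet_Ioo)
  refine hpm.mul_bdd (c := C) hgm ?_
  filter_upwards [hIoo] with z hz
  exact hC z.1 (Ioo_subset_Icc_self hz) z.2

/-- **The convective pairing against a test field is integrable** on `(0,T) × T^d` for
`u ∈ L²_{t,x}`: `|⟪u, (u·∇)Ψ⟫| = |∑ᵢ uᵢ ⟪u, ∂ᵢΨ⟫| ≤ (∑ᵢ sup|∂ᵢΨ|) ‖u‖²`. [folklore] -/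
theorem integrable_inner_convect_smooth {Ψ : ℝ → UnitAddTorus d → EuclideanSpace ℝ d}
    (hΨ : ContDiff ℝ ∞ (FunctionSpaces.Torus.stLift Ψ))
    (hum : AEStronglyMeasurable (uncurry u) ((volume.restrict (Ioo 0 T)).prod volume))
    (hu2 : Integrable (fun z : ℝ × UnitAddTorus d => ‖u z.1 z.2‖ ^ 2) ((volume.restrict (Ioo 0 T)).prod volume)) :
    Integrable (fun z : ℝ × UnitAddTorus d => ⟪u z.1 z.2, FunctionSpaces.Torus.convect (u z.1) (Ψ z.1) z.2⟫_ℝ)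
      ((volume.restrict (Ioo 0 T)).prod volume) := by
  set μ2 := (volume.restrict (Ioo 0 T)).prod (volume : Measure (UnitAddTorus d)) with hμ2
  have hΨs : FunctionSpaces.Torus.IsSmoothSpaceTimeOn univ Ψ := FunctionSpaces.Torus.isSmoothSpaceTimeOn_of_contDiff hΨ univ
  have hΨt : ∀ t, FunctionSpaces.Torus.IsContDiff 1 (Ψ t) := fun t =>
    (isSmooth_slice_of_contDiff_stLift hΨ t).isContDiff (by simp)
  -- partial derivatives: jointly smooth, bounded on `[0,T]`, measurable
  have hD : ∀ i, FunctionSpaces.Torus.IsSmoothSpaceTimeOn univ (fun t => FunctionSpaces.Torus.partialDeriv i (Ψ t)) :=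
    fun i => hΨs.partialDeriv uniqueDiffOn_univ i
  have hB : ∀ i, ∃ C : ℝ, 0 ≤ C ∧ ∀ t ∈ Icc 0 T, ∀ x, ‖FunctionSpaces.Torus.partialDeriv i (Ψ t) x‖ ≤ C :=
    fun i => ((hD i).bound_and_measurable T).1
  choose C hC0 hC using hB
  have hDm : ∀ i, AEStronglyMeasurable (fun z : ℝ × UnitAddTorus d => FunctionSpaces.Torus.partialDeriv i (Ψ z.1) z.2)
      μ2 := fun i => ((hD i).bound_and_measurable T).2
  -- the expansion `⟪u, (u·∇)Ψ⟫ = ∑ᵢ uᵢ ⟪u, ∂ᵢΨ⟫`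
  have hexp : ∀ z : ℝ × UnitAddTorus d, ⟪u z.1 z.2, FunctionSpaces.Torus.convect (u z.1) (Ψ z.1) z.2⟫_ℝ =
      ∑ i, u z.1 z.2 i * ⟪u z.1 z.2, FunctionSpaces.Torus.partialDeriv i (Ψ z.1) z.2⟫_ℝ := by
    intro z
    rw [FunctionSpaces.Torus.convect, FunctionSpaces.Torus.fderiv_apply_eq_sum_partialDeriv (hΨt z.1), inner_sum]
    refine Finset.sum_congr rfl fun i _ => ?_
    rw [real_inner_smul_right]
  have hIoo : ∀ᵐ z ∂μ2, z.1 ∈ Ioo 0 T := ae_prod_of_ae_fst (ae_restrict_mem measurableSet_Ioo)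
  have hui : ∀ i, AEStronglyMeasurable (fun z : ℝ × UnitAddTorus d => u z.1 z.2 i) μ2 := fun i =>
    (EuclideanSpace.proj i : EuclideanSpace ℝ d →L[ℝ] ℝ).continuous.comp_aestronglyMeasurable hum
  have hterm : ∀ i, Integrable (fun z : ℝ × UnitAddTorus d =>
      u z.1 z.2 i * ⟪u z.1 z.2, FunctionSpaces.Torus.partialDeriv i (Ψ z.1) z.2⟫_ℝ) μ2 := by
    intro i
    refine Integrable.mono' (hu2.mul_const (C i)) ((hui i).mul (hum.inner (hDm i))) ?_
    filter_upwards [hIoo] with z hz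
    rw [norm_mul]
    have h1 : ‖u z.1 z.2 i‖ ≤ ‖u z.1 z.2‖ := by simpa using PiLp.norm_apply_le (u z.1 z.2) i
    have h2 : ‖⟪u z.1 z.2, FunctionSpaces.Torus.partialDeriv i (Ψ z.1) z.2⟫_ℝ‖ ≤ ‖u z.1 z.2‖ * C i :=
      (norm_inner_le_norm _ _).trans (mul_le_mul_of_nonneg_left (hC i z.1 (Ioo_subset_Icc_self hz) z.2)
        (norm_nonneg _))
    calc ‖u z.1 z.2 i‖ * ‖⟪u z.1 z.2, FunctionSpaces.Torus.partialDeriv i (Ψ z.1) z.2⟫_ℝ‖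
        ≤ ‖u z.1 z.2‖ * (‖u z.1 z.2‖ * C i) := mul_le_mul h1 h2 (norm_nonneg _) (norm_nonneg _)
      _ = ‖u z.1 z.2‖ ^ 2 * C i := by ring
  have h := integrable_finsetSum (Finset.univ : Finset d) fun i _ => hterm i
  refine h.congr (ae_of_all _ fun z => ?_)
  exact (hexp z).symm

set_option maxHeartbeats 800000 in
/-- **The distributional identity splits into its four pairings**: for an (unforced)
distributional solution `(u, p)` on `T^d × (0,T)` and a test field `Ψ` supported in `(0,T)`,
`∫₀ᵀ∫ ⟪u, ∂ₜΨ⟫ + ∫₀ᵀ∫ ⟪u, (u·∇)Ψ⟫ + ν∫₀ᵀ∫ ⟪u, ΔΨ⟫ + ∫₀ᵀ∫ p div Ψ = 0` (each pairing is integrable on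
`(0,T) × T^d`: `u ∈ L²_{t,x}`, `p ∈ L¹_{t,x}`, the derived fields of `Ψ` are bounded on `[0,T]`; Fubini). [folklore] -/
theorem IsDistributionalNSSolutionOn.weakForm_split (hsol : IsDistributionalNSSolutionOn T ν 0 u p)
    {Ψ : ℝ → UnitAddTorus d → EuclideanSpace ℝ d} (hΨ : FunctionSpaces.Torus.IsSpaceTimeTestIoo T Ψ) :
    (∫ t in Ioo 0 T, ∫ x, ⟪u t x, FunctionSpaces.Torus.timeDeriv Ψ t x⟫_ℝ) +
      (∫ t in Ioo 0 T, ∫ x, ⟪u t x, FunctionSpaces.Torus.convect (u t) (Ψ t) x⟫_ℝ) +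
      ν * (∫ t in Ioo 0 T, ∫ x, ⟪u t x, FunctionSpaces.Torus.laplacian (Ψ t) x⟫_ℝ) +
      (∫ t in Ioo 0 T, ∫ x, p t x * FunctionSpaces.Torus.divergence (Ψ t) x) = 0 := by
  set μ2 := (volume.restrict (Ioo 0 T)).prod (volume : Measure (UnitAddTorus d)) with hμ2
  have hΨc : ContDiff ℝ ∞ (FunctionSpaces.Torus.stLift Ψ) := hΨ.1.1
  have hΨs : FunctionSpaces.Torus.IsSmoothSpaceTimeOn univ Ψ := FunctionSpaces.Torus.isSmoothSpaceTimeOn_of_contDiff hΨc univ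
  -- the data
  have hum : AEStronglyMeasurable (uncurry u) μ2 := aestronglyMeasurable_uncurry_prod hsol.1
  have hpm : AEStronglyMeasurable (uncurry p) μ2 := aestronglyMeasurable_uncurry_prod hsol.2.2.1
  have hu2 : Integrable (fun z : ℝ × UnitAddTorus d => ‖u z.1 z.2‖ ^ 2) μ2 := by
    refine ⟨(continuous_norm.pow 2).comp_aestronglyMeasurable hum, ?_⟩
    have h := hsol.2.1
    rw [lintegral_Ioo_lintegral_eq_lintegral_prod (hum.enorm.pow_const _)] at h
    refine (hasFiniteIntegral_iff_enorm.2 ?_)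
    refine lt_of_le_of_lt (lintegral_mono fun z => le_of_eq ?_) h
    rw [Real.enorm_eq_ofReal (sq_nonneg _), ← ofReal_norm, ← ENNReal.ofReal_pow (norm_nonneg _)]
  have hu1 : Integrable (uncurry u) μ2 := by
    have h2 : MemLp (uncurry u) 2 μ2 := (memLp_two_iff_integrable_sq_norm hum).2 hu2
    haveI : IsFiniteMeasure μ2 := by
      refine ⟨?_⟩
      rw [hμ2, prod_Ioo_univ]; exact ENNReal.ofReal_lt_top
    exact h2.integrable one_le_two
  have hp1 : Integrable (uncurry p) μ2 := by
    refine ⟨hpm, hasFiniteIntegral_iff_enorm.2 ?_⟩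
    have h := hsol.2.2.2.1
    rwa [lintegral_Ioo_lintegral_eq_lintegral_prod hpm.enorm] at h
  -- the four integrands on the product
  obtain ⟨fA, hfA⟩ : ∃ f : ℝ × UnitAddTorus d → ℝ,
      f = fun z => ⟪u z.1 z.2, FunctionSpaces.Torus.timeDeriv Ψ z.1 z.2⟫_ℝ := ⟨_, rfl⟩
  obtain ⟨fB, hfB⟩ : ∃ f : ℝ × UnitAddTorus d → ℝ,
      f = fun z => ⟪u z.1 z.2, FunctionSpaces.Torus.convect (u z.1) (Ψ z.1) z.2⟫_ℝ := ⟨_, rfl⟩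
  obtain ⟨fC, hfC⟩ : ∃ f : ℝ × UnitAddTorus d → ℝ,
      f = fun z => ⟪u z.1 z.2, FunctionSpaces.Torus.laplacian (Ψ z.1) z.2⟫_ℝ := ⟨_, rfl⟩
  obtain ⟨fD, hfD⟩ : ∃ f : ℝ × UnitAddTorus d → ℝ,
      f = fun z => p z.1 z.2 * FunctionSpaces.Torus.divergence (Ψ z.1) z.2 := ⟨_, rfl⟩
  have hTs : FunctionSpaces.Torus.IsSmoothSpaceTimeOn univ (FunctionSpaces.Torus.timeDeriv Ψ) :=
    hΨ.1.timeDeriv.isSmoothSpaceTimeOn univ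
  have hLs : FunctionSpaces.Torus.IsSmoothSpaceTimeOn univ (fun t => FunctionSpaces.Torus.laplacian (Ψ t)) :=
    hΨs.laplacian uniqueDiffOn_univ
  have hDs : FunctionSpaces.Torus.IsSmoothSpaceTimeOn univ (fun t => FunctionSpaces.Torus.divergence (Ψ t)) :=
    hΨs.divergence uniqueDiffOn_univ
  have hIA : Integrable fA μ2 := by
    rw [hfA]; exact integrable_inner_smooth (V := FunctionSpaces.Torus.timeDeriv Ψ) hTs hu1
  have hIB : Integrable fB μ2 := by rw [hfB]; exact integrable_inner_convect_smooth hΨc hum hu2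
  have hIC : Integrable fC μ2 := by
    rw [hfC]; exact integrable_inner_smooth (V := fun t x => FunctionSpaces.Torus.laplacian (Ψ t) x) hLs hu1
  have hID : Integrable fD μ2 := by
    rw [hfD]; exact integrable_mul_smooth (g := fun t x => FunctionSpaces.Torus.divergence (Ψ t) x) hDs hp1
  -- the identity
  have h := hsol.2.2.2.2.2 Ψ hΨ
  have hsum : Integrable (fun z => fA z + fB z + ν * fC z + fD z) μ2 := ((hIA.add hIB).add (hIC.const_mul ν)).add hID
  have e0 : ∫ t in Ioo 0 T, ∫ x, (⟪u t x, FunctionSpaces.Torus.timeDeriv Ψ t x⟫_ℝ +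
      ⟪u t x, FunctionSpaces.Torus.convect (u t) (Ψ t) x⟫_ℝ + ν * ⟪u t x, FunctionSpaces.Torus.laplacian (Ψ t) x⟫_ℝ +
      p t x * FunctionSpaces.Torus.divergence (Ψ t) x + ⟪(0 : ℝ → UnitAddTorus d → EuclideanSpace ℝ d) t x, Ψ t x⟫_ℝ) =
      ∫ z, (fA z + fB z + ν * fC z + fD z) ∂μ2 := by
    rw [integral_prod _ hsum]
    refine integral_congr_ae (ae_of_all _ fun t => integral_congr_ae (ae_of_all _ fun x => ?_))
    simp [hfA, hfB, hfC, hfD]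
  rw [e0] at h
  have hAB : Integrable (fun z => fA z + fB z) μ2 := hIA.add hIB
  have hC' : Integrable (fun z => ν * fC z) μ2 := hIC.const_mul ν
  have hABC : Integrable (fun z => fA z + fB z + ν * fC z) μ2 := hAB.add hC'
  rw [integral_add hABC hID, integral_add hAB hC', integral_add hIA hIB, integral_const_mul] at h
  have eA : ∫ a, fA a ∂μ2 = ∫ t in Ioo 0 T, ∫ x, fA (t, x) := integral_prod fA hIA
  have eB : ∫ a, fB a ∂μ2 = ∫ t in Ioo 0 T, ∫ x, fB (t, x) := integral_prod fB hIB
  have eC : ∫ a, fC a ∂μ2 = ∫ t in Ioo 0 T, ∫ x, fC (t, x) := integral_prod fC hIC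
  have eD : ∫ a, fD a ∂μ2 = ∫ t in Ioo 0 T, ∫ x, fD (t, x) := integral_prod fD hID
  rw [eA, eB, eC, eD] at h
  subst hfA hfB hfC hfD
  exact h

end Split

/-! ## Assembly: the tested momentum equation from (E1)–(E3) -/

section Assembly

/-- **Duchon–Robert's tested momentum equation from the three analytic steps**: the named fact
`IsDistributionalNSSolutionOn.symmTestField_identity` (Duchon–Robert 2000, proof of Prop. 1,
p. 250) follows from (E1) the admissibility of the approximating fields `Φₙ`, (E2) the exact
time-derivative pairing and (E3) the removal of the regularisation: the distributional identity for
`Φₙ` splits into its four pairings (`weakForm_split`), the first of which is `∫∫⟪wₙ, wₙ⋆K⟫∂ₜψ` by (E2),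
and letting `n → ∞` term by term by (E3) gives the identity for `Φ = ψ u^K + (ψu) ⋆ K`. The radii
of the time bumps are chosen smaller than the distance of the time support of `ψ` to `{0, T}`
(`exists_contDiffBump_seq_lt`), the space radii are `1/(n+4)`. [cite: DuchonRobert2000, proof of Prop. 1 p. 250] -/
theorem symmTestField_identity_of (h1 : drTestApprox_isSpaceTimeTestIoo (d := d))
    (h2 : drTestApprox_timePairing (d := d)) (h3 : drTestApprox_limits (d := d)) :
    IsDistributionalNSSolutionOn.symmTestField_identity (d := d) := by
  intro T ν u p hsol hu3 hp K hK hKev ψ hψ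
  -- the time support of `ψ`
  obtain ⟨⟨hψc, T', hT', hψT'⟩, ε₀, hε₀, hψε₀⟩ := hψ
  by_cases hT : T' < ε₀
  · -- then `ψ` vanishes identically and every term is zero
    have hψ0 : ∀ t, ψ t = 0 := fun t => by
      by_cases ht : t ≤ ε₀
      · exact hψε₀ t ht
      · exact hψT' t (by linarith [not_le.1 ht])
    have hS0 : ∀ t, symmTestField K (ψ t) (u t) = 0 := fun t => by
      funext x
      rw [symmTestField_apply, hψ0 t]
      have e : (fun y => (0 : UnitAddTorus d → ℝ) y • u t y) = 0 := by funext y; simp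
      rw [e, vecConv_zero]
      simp
    have hdt : ∀ t x, FunctionSpaces.Torus.timeDeriv ψ t x = 0 := fun t x => by
      have e : (fun τ => ψ τ x) = fun _ => 0 := funext fun τ => by rw [hψ0 τ]; rfl
      simp [FunctionSpaces.Torus.timeDeriv, e]
    simp only [hS0, hdt, mul_zero, integral_zero]
    have hc : ∀ t x, FunctionSpaces.Torus.convect (u t) (0 : UnitAddTorus d → EuclideanSpace ℝ d) x = 0 := fun t x => by
      have e : FunctionSpaces.Torus.liftAt (0 : UnitAddTorus d → EuclideanSpace ℝ d) x = fun _ => 0 := rfl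
      simp [FunctionSpaces.Torus.convect, FunctionSpaces.Torus.fderiv, e]
    have hl : ∀ x, FunctionSpaces.Torus.laplacian (0 : UnitAddTorus d → EuclideanSpace ℝ d) x = 0 := fun x => by
      show FunctionSpaces.Torus.laplacian (fun _ : UnitAddTorus d => (0 : EuclideanSpace ℝ d)) x = 0
      rw [FunctionSpaces.Torus.laplacian_eq_sum_partialDeriv_partialDeriv
        (FunctionSpaces.Torus.isSmooth_const (0 : EuclideanSpace ℝ d))]
      refine Finset.sum_eq_zero fun i _ => ?_
      have h1 : FunctionSpaces.Torus.partialDeriv i (fun _ : UnitAddTorus d => (0 : EuclideanSpace ℝ d)) = fun _ => 0 := by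
        funext y; simp [FunctionSpaces.Torus.partialDeriv, FunctionSpaces.Torus.lineDeriv]
      rw [h1]
      simp [FunctionSpaces.Torus.partialDeriv, FunctionSpaces.Torus.lineDeriv]
    have hdv : ∀ x, FunctionSpaces.Torus.divergence (0 : UnitAddTorus d → EuclideanSpace ℝ d) x = 0 := fun x => by
      simp [FunctionSpaces.Torus.divergence, FunctionSpaces.Torus.partialDeriv, FunctionSpaces.Torus.lineDeriv]
    simp [hc, hl, hdv]
  push Not at hT
  -- bumps with radii below `δ₀ = min ε₀ (T - T') / 2`
  set δ₀ : ℝ := min ε₀ (T - T') / 2 with hδ₀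
  have hδ₀pos : 0 < δ₀ := by
    rw [hδ₀]; exact div_pos (lt_min hε₀ (by linarith)) two_pos
  obtain ⟨φ, hφlt, hφ0⟩ := exists_contDiffBump_seq_lt hδ₀pos
  set εs : ℕ → ℝ := fun n => 1 / ((n : ℝ) + 4) with hεs
  have hεs_prop : ∀ n, 0 < εs n ∧ εs n ≤ 1 / 4 := fun n =>
    ⟨presMollifier_radius_pos n, presMollifier_radius_le n⟩
  have hεs0 : Tendsto εs atTop (𝓝 0) := by
    have h4 : Tendsto (fun n : ℕ => ((n : ℝ) + 4)) atTop atTop :=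
      tendsto_atTop_add_const_right _ _ tendsto_natCast_atTop_atTop
    have := tendsto_inv_atTop_zero.comp h4
    simpa only [hεs, Function.comp_def, one_div] using this
  -- data
  have hmeas := hsol.1
  have hu2 : ∫⁻ t in Ioo 0 T, ∫⁻ x, ‖u t x‖ₑ ^ 2 < ⊤ := hsol.2.1
  have hψ' : FunctionSpaces.Torus.IsSpaceTimeTestIoo T ψ := ⟨⟨hψc, T', hT', hψT'⟩, ε₀, hε₀, hψε₀⟩
  -- (E1): each `Φₙ` is a test field
  have hE1 : ∀ n, FunctionSpaces.Torus.IsSpaceTimeTestIoo T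
      (drTestApprox T u ((φ n).normed volume) (FunctionSpaces.Torus.kernel (εs n)) K ψ) := by
    intro n
    have hr : (φ n).rOut < δ₀ := hφlt n
    have hmin : δ₀ ≤ ε₀ / 2 ∧ δ₀ ≤ (T - T') / 2 := by
      rw [hδ₀]; exact ⟨by gcongr; exact min_le_left _ _, by gcongr; exact min_le_right _ _⟩
    exact h1 hmeas hu2 (φ n) (hεs_prop n).1 (hεs_prop n).2 hK hψc hψε₀ (fun t ht => hψT' t ht)
      (by linarith [hmin.1]) (by linarith [hmin.2])
  -- the split identity for each `n`, with the exact time pairing (E2)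
  have hid : ∀ n,
      (∫ t in Ioo 0 T, ∫ x, ⟪drVelocityApprox T u ((φ n).normed volume) (FunctionSpaces.Torus.kernel (εs n)) t x,
          vecConv (drVelocityApprox T u ((φ n).normed volume) (FunctionSpaces.Torus.kernel (εs n)) t) K x⟫_ℝ *
          FunctionSpaces.Torus.timeDeriv ψ t x) +
      (∫ t in Ioo 0 T, ∫ x, ⟪u t x, FunctionSpaces.Torus.convect (u t)
          (drTestApprox T u ((φ n).normed volume) (FunctionSpaces.Torus.kernel (εs n)) K ψ t) x⟫_ℝ) +
      ν * (∫ t in Ioo 0 T, ∫ x, ⟪u t x, FunctionSpaces.Torus.laplacian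
          (drTestApprox T u ((φ n).normed volume) (FunctionSpaces.Torus.kernel (εs n)) K ψ t) x⟫_ℝ) +
      (∫ t in Ioo 0 T, ∫ x, p t x * FunctionSpaces.Torus.divergence
          (drTestApprox T u ((φ n).normed volume) (FunctionSpaces.Torus.kernel (εs n)) K ψ t) x) = 0 := by
    intro n
    have h := hsol.weakForm_split (hE1 n)
    rwa [h2 hmeas hu2 (φ n) (hεs_prop n).1 (hεs_prop n).2 hK hKev hψ'] at h
  -- (E3): pass to the limit
  obtain ⟨la, lb, lc, ld⟩ := h3 hmeas hu3 hsol.2.2.1 hp hK hKev hψ' φ hφ0 εs hεs_prop hεs0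
  have hlim := ((la.add lb).add (lc.const_mul ν)).add ld
  have hzero : Tendsto (fun n : ℕ => (0 : ℝ)) atTop (𝓝
      ((∫ t in Ioo 0 T, ∫ x, ⟪u t x, vecConv (u t) K x⟫_ℝ * FunctionSpaces.Torus.timeDeriv ψ t x) +
      (∫ t in Ioo 0 T, ∫ x, ⟪u t x, FunctionSpaces.Torus.convect (u t) (symmTestField K (ψ t) (u t)) x⟫_ℝ) +
      ν * (∫ t in Ioo 0 T, ∫ x, ⟪u t x, FunctionSpaces.Torus.laplacian (symmTestField K (ψ t) (u t)) x⟫_ℝ) +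
      (∫ t in Ioo 0 T, ∫ x, p t x * FunctionSpaces.Torus.divergence (symmTestField K (ψ t) (u t)) x))) :=
    hlim.congr fun n => hid n
  exact tendsto_nhds_unique hzero tendsto_const_nhds

end Assembly

end Literature.Analysis.FluidPDE.Torus
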